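import Mathlib.RingTheory.MvPolynomial.Homogeneous
import Literature.Computability.AlgebraicComplexity.RankMethodBarriers
import HarnessLib

/-!
# Barrier catalogue `ValiantsHypothesis`: barriers for rank methods
(Efremenko–Garg–Oliveira–Wigderson 2018) — flattenings cannot certify tensor rank above
`2^d · n^{⌊d/2⌋}` nor Waring rank above `(d+1) · binom(n+⌊d/2⌋, n)`

D-0021 barrier entry for the summit `ValiantsHypothesis` (`VP_ℂ ≠ VNP_ℂ`). The printed theorems
and the framework (`S`-complexity, rank measures `μ_L(f) = rank L(f)`, the ceiling
`RankMethodCeiling`) are vendored in `Literature/Computability/AlgebraicComplexity/RankMethodBarriers.lean`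
(`CplxAlg.EGOW2018_thm44`/`thm11`, `CplxAlg.EGOW2018_thm42`/`thm12`, named facts); this entry
fixes the TECHNIQUE CLASS in attackable form ("a rank method certifies tensor rank `> B`",
`TensorRankMethodProves`; Waring analogue `WaringRankMethodProves`), takes as barrier fact the
conjunction of the two headline theorems (`RankMethods := EGOW2018_thm11 ∧ EGOW2018_thm12`, no
restatement drift), and PROVES the no-go consequences, including the comparison with the
threshold of Raz's tensor-rank route to formula lower bounds.

**The printed results** (arXiv:1710.09502 = ITCS 2018, checked with `lit read`).

* §1.1: rank methods `Δ₀^S` = sub-additive measures `μ_L(f) = rank_F(L(f))` for linear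
  `L : Ŝ → Mat_m(F)`; "partial derivatives, shifted partial derivatives, evaluation dimension,
  coefficient dimension ... are all rank methods"; "We do not restrict the size `m` ... we demand
  no explicitness in the specification of the linear map `L` ... The barrier results hold for all."
* Thm. 1.1: `c(Δ₀^T) ≤ 2^d · n^{⌊d/2⌋}` — "no bound better [than] `2^d · n^{⌊d/2⌋}` can be proven by
  rank methods, and in particular for `d = 3`, they cannot beat `8n`". Thm. 1.2:
  `c(Δ₀^W) ≤ (d+1) · binom(n+⌊d/2⌋, n)`. §1.2: "Our results below hold for all large enough fields
  `𝔽` (polynomial in `n,d`)"; §2.1 standing assumption: algebraically closed of characteristic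
  zero (the tree vendors this).
* §1.1 (the route blocked): "Raz [Raz10] proved that presenting an explicit tensor `f` of
  super-constant dimension `d ≤ log n / log log n`, with a nearly-tight tensor rank lower bound
  of `n^{d(1-o(1))}` (which holds for most tensors) will imply `VP_e ≠ VNP` (namely, explicit
  super-polynomial lower bounds on formulas)!"; abstract: the ceilings "are a far cry
  (quadratically away) from the true complexity ... which if achieved (by any methods), are known
  to imply super-polynomial formula lower bounds."
* Raz, J. ACM 60 (2013) 40, §1.4: "for any such `A`, if there exists an arithmetic formula of
  size `n^c` for `f_A` then the tensor-rank of `A` is at most `n^{r(1-2^{-O(c)})}`. Thus, a lower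
  bound of `n^{r(1-o(1))}` for the tensor-rank of `A` implies a super-polynomial lower bound for
  the size of any arithmetic formula for `f_A`", and footnote 2: "by the completeness of the
  permanent [Val79], if the tensor `A` is 'explicit' the super-polynomial lower bound holds for
  the permanent."
* §1.4 (p. 7): "our barrier results are completely unconditional, and moreover require no
  constructivity from the lower bound proof ... On the other hand, our framework of rank methods
  capture only a large subset, but certainly not all of the known lower bound techniques."

**Barrier audit 2026-08-16 (D-0021, refuter; verdict: CONFIRMED, scope lines sharpened).**
(i) Technique class: Thm. 4.4 / Thm. 4.2 quantify over every linear `L` and every `m`, exactly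
`TensorRankMethodProves` / `WaringRankMethodProves`; the printed proofs (Lem. 3.2, 3.3, 3.5,
Prop. 2.8, 2.12, pp. 9–14) were re-read and are sound (Thm. 4.4 even yields
`rank L(T) ≤ r · Σ_k binom(d,k) n^{min(k,d-k)}`). The one formal gap found — a Def. 4.1 method
bounding `rank L(ℓ^d)` only for LINEAR `ℓ` is not literally an instance of
`WaringRankMethodProves` (affine `ℓ`, as printed in Thm. 4.2) — is closed below for homogeneous
targets (`RankMethods.not_linearWaringRankMethodProves`, via `L ∘ homogeneousComponent d`).
(ii) Scope: the ceilings were since SHARPENED, not weakened — Garg–Makam–Oliveira–Wigderson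
(FOCS 2019, arXiv:1904.04299) Thm. 8.4 / Cor. 8.5: rank-method potency for tensors in
`F^{n₁} ⊗ F^{n₂} ⊗ F^{n₃}` is `≤ 2n₁ + 2n₂ + 2n₃ − 4` (so `6n − 4`, not just `8n`, for `d = 3`) and for
Waring rank of degree-`(2k+1)` forms in `n+1` variables `≤ 2·binom(n+k, k)`, matching the
cactus-variety bounds (Bernardi–Ranestad, Gałązka, Buczyński); Thms. 1.14–1.19 there extend the
barrier to "`T_k`- and `W_k`-rank methods" (linear maps into `k`-tensors / degree-`k` forms
measured by tensor / Waring rank): potency `≤ C_{d,k} · n^{⌊(k-1)d/k⌋}` (`C_{d,k} = k^d` for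
tensors to tensors), and §7 to border-rank methods (all over algebraically closed fields of
characteristic zero). Field hypothesis: EGOW
p. 8 fn. needs `|F|` polynomial in `n`, `d` AND the matrix size `m` and "cannot work over field
extensions" — over a fixed small finite field with unbounded `m` nothing is printed (irrelevant
to `VP_ℂ`). (iii) Raz 2013 contains THREE escalations (abstract, pp. 1–3): (a) tensor rank
`≥ n^{r(1-o(1))}`, `r ≤ log n/log log n`; (b) super-polynomial HOMOGENEOUS-formula lower bounds
for degree `r ≤ O(log n)` (blow-up `binom(depth+r+1, r) · s`); (c) super-polynomial
SET-MULTILINEAR-formula lower bounds for `r ≤ O(log n/log log n)` (blow-up `O((depth+2)^r s)`).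
This barrier speaks to (a) only: rank methods against unbounded-depth set-multilinear or
homogeneous FORMULAS are not capped by any printed barrier — Limaye–Srinivasan–Tavenas
(CCC 2022) §1.3: the known barrier results "are either conditional, or hold for relatively weak
models of computation (such as set-multilinear formulas of product-depth 1)"; their own
limitation (abstract, item 3) is specific to the lopsided relative-rank measure at small
product-depth; all known arbitrary-depth set-multilinear formula bounds are "FPT",
`Ω(f(d)·poly(N))` (Tavenas–Limaye–Srinivasan, STOC 2022, §1), and against sums of ordered
set-multilinear ABPs relative-rank flattenings give `n^{ω(1)}` for `d = ω(log n)`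
(Chatterjee–Kush–Saraf–Shpilka, CCC 2024, Thm. 1), just short of the `d = O(log n/log log n)`
needed by the ABP escalation of Bhargav–Dwivedi–Saxena (ibid., Thm. 2).

## References

* [EfremenkoGargOliveiraWigderson2018] K. Efremenko, A. Garg, R. Oliveira, A. Wigderson,
  *Barriers for rank methods in arithmetic complexity*, ITCS 2018 (arXiv:1710.09502), abstract,
  §1.1–1.4, Thm. 1.1, Thm. 1.2, Thm. 4.2, Thm. 4.4, §6.
* [Raz2013] R. Raz, *Tensor-rank and lower bounds for arithmetic formulas*, J. ACM 60 (2013)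
  40 (STOC 2010), abstract and §1.4.
* [GargMakamOliveiraWigderson2019] A. Garg, V. Makam, R. Oliveira, A. Wigderson, *More barriers
  for rank methods, via a "numeric to symbolic" transfer*, FOCS 2019 (arXiv:1904.04299), §1.3–1.6,
  Thm. 8.4, Cor. 8.5.
* [LimayeSrinivasanTavenas2022] N. Limaye, S. Srinivasan, S. Tavenas, *On the partial derivative
  method applied to lopsided set-multilinear polynomials*, CCC 2022 (LIPIcs 234:32), abstract and
  §1.3.
* [TavenasLimayeSrinivasan2022] S. Tavenas, N. Limaye, S. Srinivasan, *Set-multilinear and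
  non-commutative formula lower bounds for iterated matrix multiplication*, STOC 2022, §1.
* [ChatterjeeKushSarafShpilka2024] P. Chatterjee, D. Kush, S. Saraf, A. Shpilka, *Lower bounds for
  set-multilinear branching programs*, CCC 2024 (arXiv:2312.15874), §1.2–1.3.
* [LandsbergMichalek2019] J. M. Landsberg, M. Michałek, *Towards finding hay in a haystack:
  explicit tensors of border rank greater than 2.02m in C^m⊗C^m⊗C^m*, arXiv:1912.11927, abstract
  and Rem. 2.3.
-/

noncomputable section

namespace Literature.Barriers.ValiantsHypothesis

open Literature.Computability.AlgebraicComplexity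

/-! ### Technique classes: what it means for a rank method to prove a bound -/

/-- **Technique class (tensor rank).** A rank method CERTIFIES `tensor rank(T) > B` for a
`d`-dimensional tensor `T` of side `n` over `F`: there are a matrix size `m`, a linear
flattening `L : Ten_{n,d}(F) → Mat_m(F)` and a bound `r` with `rank L(u₁ ⊗ ⋯ ⊗ u_d) ≤ r` on all
rank-one tensors and `rank L(T) > B · r` — by sub-additivity this proves `c_S(T) > B`
(`TensorRankMethodProves.lt_tensorRankD`). No restriction on `m` or on the explicitness of `L`
(EGOW §1.1). [cite: EfremenkoGargOliveiraWigderson2018, §1.1] -/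
def TensorRankMethodProves (F : Type) [Field F] (n d B : ℕ) (T : (Fin d → Fin n) → F) : Prop :=
  ∃ (m : ℕ) (L : ((Fin d → Fin n) → F) →ₗ[F] Matrix (Fin m) (Fin m) F) (r : ℕ),
    (∀ u : Fin d → Fin n → F, (L (rankOneTensor u)).rank ≤ r) ∧ B * r < (L T).rank

/-- **Technique class (Waring rank).** A rank method certifies "`f` is not a sum of `B` `d`-th
powers of affine forms": a linear `L : F[x₁..x_n] → Mat_m(F)` with `rank L(ℓ^d) ≤ r` for all
affine `ℓ` and `rank L(f) > B · r`. [cite: EfremenkoGargOliveiraWigderson2018, §1.1 and Def. 4.1] -/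
def WaringRankMethodProves (F : Type) [Field F] (n d B : ℕ) (f : MvPolynomial (Fin n) F) : Prop :=
  ∃ (m : ℕ) (L : MvPolynomial (Fin n) F →ₗ[F] Matrix (Fin m) (Fin m) F) (r : ℕ),
    (∀ (a₀ : F) (a : Fin n → F), (L (affineForm a₀ a ^ d)).rank ≤ r) ∧ B * r < (L f).rank

/-- Soundness of the technique: a certificate `rank L(T) > B · r` proves `tensorRankD T > B`
whenever `T` has some rank-one decomposition (rank is sub-additive:
`rank L(T) ≤ c_S(T) · r`, tree `CplxAlg.rankMeasure_le_sComplexity_mul`).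
[cite: EfremenkoGargOliveiraWigderson2018, §1.1] -/
theorem TensorRankMethodProves.lt_tensorRankD {F : Type} [Field F] {n d B : ℕ}
    {T : (Fin d → Fin n) → F} (h : TensorRankMethodProves F n d B T)
    (hT : ∃ s : ℕ, ∃ g : Fin s → (Fin d → Fin n) → F, (∀ i, g i ∈ rankOneTensors F n d) ∧ ∑ i, g i = T) :
    B < tensorRankD T := by
  obtain ⟨m, L, r, hr, hlt⟩ := h
  have hle : rankMeasure L T ≤ sComplexity (rankOneTensors F n d) T * r :=
    rankMeasure_le_sComplexity_mul L (by rintro _ ⟨u, rfl⟩; exact hr u) hT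
  rw [rankMeasure_apply] at hle
  have : B * r < tensorRankD T * r := lt_of_lt_of_le hlt hle
  exact lt_of_mul_lt_mul_right this (Nat.zero_le _)

/-! ### The barrier fact -/

/-- **Barriers for rank methods (Efremenko–Garg–Oliveira–Wigderson 2018, Thm. 1.1 and
Thm. 1.2):** over an algebraically closed field of characteristic zero and for `n ≥ 1`,
`c(Δ₀^T) ≤ 2^d · n^{⌊d/2⌋}` (tensor rank) and `c(Δ₀^W) ≤ (d+1) · binom(n+⌊d/2⌋, n)` (Waring rank,
simple set = `d`-th powers of affine forms, targets of degree `≤ d`). This barrier fact IS the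
conjunction of the tree's named facts `CplxAlg.EGOW2018_thm11` and `CplxAlg.EGOW2018_thm12`
(`RankMethodBarriers.lean`; they follow from the vendored Thm. 4.4 / Thm. 4.2,
`rankMethods_of_thm44_thm42`).

BARRIER
technique_class: rank-methods, flattenings, sub-additive rank measures `μ_L(f) = rank L(f)` (partial derivatives, shifted partial derivatives, evaluation dimension, coefficient dimension, Young flattenings), any matrix size, any (non-explicit) linear map
blocks: Raz's tensor-rank route to super-polynomial FORMULA lower bounds for the permanent (`VP_e ≠ VNP`, a consequence of `ValiantsHypothesis`): an explicit `d`-dimensional tensor of side `n`, `d ≤ log n / log log n` super-constant, of tensor rank `≥ n^{d(1-o(1))}` would give it [cite: Raz2013, §1.4 (with footnote 2)], but no rank method certifies tensor rank above `2^d · n^{⌊d/2⌋}` for ANY tensor (`RankMethods.not_tensorRankMethodProves`), which is `≤ n^{⌈3d/4⌉}` once `n ≥ 16` (`two_pow_mul_pow_half_le`), "a far cry (quadratically away) from the true complexity ... which if achieved (by any methods), are known to imply super-polynomial formula lower bounds" [cite: EfremenkoGargOliveiraWigderson2018, abstract and §1.1]; likewise no rank method certifies Waring rank (sums of `d`-th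 powers of affine forms, "a very restricted form of depth-3 circuits") above `(d+1) · binom(n+⌊d/2⌋, n)` for any polynomial of degree `≤ d` (`RankMethods.not_waringRankMethodProves`) [cite: EfremenkoGargOliveiraWigderson2018, Thm. 1.2].
because: view `L` restricted to the parametrised simple set as a matrix polynomial `L(S)`; its symbolic rank is at most the maximal rank `r` of an evaluation (large field); a rank-`r` factorisation over rational functions is upgraded, at the cost `r' = 2^d r` (tensors) or `(d+1) r` (Waring), to a factorisation `L(S) = K'M'` with polynomial, columnwise and rowwise homogeneous entries; as entries of `L(S)` have degree `d`, each of the `r'` column/row pairs has one side of degree `≤ ⌊d/2⌋`, whose coefficient vectors span at most `D ≈ n^{⌊d/2⌋}` constant vectors; by linearity every `L(f)`, `f ∈ Ŝ`, inherits the decomposition, so `rank L(f) ≤ r'D` and `c(Δ₀^S) ≤ r'D/r` [cite: EfremenkoGargOliveiraWigderson2018, §1.3].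
evasions_known: the substitution method and other techniques outside rank methods are not covered ("our framework of rank methods capture only a large subset, but certainly not all of the known lower bound techniques") [cite: EfremenkoGargOliveiraWigderson2018, §1.4]; the best explicit tensor-rank bounds `2n^{⌊d/2⌋} + n - O(d log n)` (Alexeev–Forbes–Tsimerman) are "not attained via a rank method" [cite: EfremenkoGargOliveiraWigderson2018, §1.2]; the authors propose rank methods for (non-homogeneous) depth-3 formulas as a direction where the barrier is not known to bite [cite: EfremenkoGargOliveiraWigderson2018, §1.4 (outline of §5)]; NON-LINEAR maps `L` ("possibly of low degree") are explicitly left open [cite: EfremenkoGargOliveiraWigderson2018, §6 (open problem 1)] — note (audit remark, not in print) that a degree-`q` polynomial rank method `Q(T) = Q̃(T^{⊗q})`, `Q̃` linear on `Ten_{n,dq}`, used through the bound `rank Q(Σ_{i≤s} gᵢ) ≤ s^q · max_{u rank-one} rank Q̃(u)`, inherits from Thm. 4.4 on `Ten_{n,dq}` only the cap `s ≤ 2^d · n^{⌊dq/2⌋/q}`, which for odd `d` and even `q` is `2^d · n^{d/2}`, a factor `√n` above the linear ceiling; for 3-tensors the border-substitution method combined with Koszul flattenings certifies border rank `≥ 2.02m`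 in `ℂ^m ⊗ ℂ^m ⊗ ℂ^m`, "overcoming a longstanding barrier", with "an absolute limit ... roughly `3m − 3√(3m)`" for that combination [cite: LandsbergMichalek2019, abstract and Rem. 2.3]; rank methods against unbounded-depth SET-MULTILINEAR or HOMOGENEOUS formulas (Raz's escalations (b), (c) of the audit note above) are outside every printed barrier — "all such results are either conditional, or hold for relatively weak models of computation (such as set-multilinear formulas of product-depth 1)" [cite: LimayeSrinivasanTavenas2022, §1.3] — the only limitation known there being specific to the lopsided relative-rank measure at small product-depth [cite: LimayeSrinivasanTavenas2022, abstract (item 3)], while every known arbitrary-depth set-multilinear formula bound is of FPT shape `Ω(f(d)·poly(N))` [cite: TavenasLimayeSrinivasan2022, §1] and, against sums of ordered set-multilinear ABPs, relative-rank flattenings give `n^{ω(1)}` for `d = ω(log n)`, just short of the `d = O(log n/log log n)` the ABP escalation needs [cite: ChatterjeeKushSarafShpilka2024, Thm. 1 and Thm. 2].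
scope_caveats: proved only for the two weakest models, tensor rank and Waring rank (they "scale up for stronger models automatically" only in the sense that lower bounds for stronger models are harder) [cite: EfremenkoGargOliveiraWigderson2018, §1.1]; nothing is printed about rank methods for general circuits, `VP`, homogeneous `ΣΠΣΠ` or the permanent-versus-determinant flattenings, so `ValiantsHypothesis` itself is touched only through Raz's formula route (`VP_e`, not `VP`) and through Waring/depth-3 powering bounds, whose ceiling `(d+1)·binom(n+⌊d/2⌋, n)` is exponential for `d = n^{Ω(1)}` and hence does not by itself preclude crossing the depth-3 chasm; the tree vendors the theorems under `[IsAlgClosed F] [CharZero F]` and `0 < n` (print: all large enough fields — `|F|` polynomial in `n`, `d` and the matrix size `m`, and "we cannot work over field extensions", so over a fixed small finite field with unbounded `m` nothing is claimed [cite: EfremenkoGargOliveiraWigderson2018, §2.1 (footnote)]); the constants have since been SHARPENED (stronger barrier, same technique class): `2n₁ + 2n₂ + 2n₃ − 4` for `F^{n₁} ⊗ F^{n₂} ⊗ F^{n₃}` (so `6n − 4` instead of `8n` for `d = 3`) and `2·binom(n+k, k)` for Waring rank of degree-`(2k+1)` forms in `n+1` variables, matching the cactus-variety bounds, while linear maps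 into `k`-tensors / degree-`k` forms measured by tensor / Waring rank ("`T_k`- and `W_k`-rank methods") are capped at `C_{d,k} · n^{⌊(k-1)d/k⌋}` (`C_{d,k} = k^d` for tensors to tensors) and border-rank methods are treated likewise [cite: GargMakamOliveiraWigderson2019, Thm. 1.14–1.19, §7, Thm. 8.4 and Cor. 8.5]; the technique-class predicate `WaringRankMethodProves` asks the rank bound on AFFINE powers as in the printed Thm. 4.2 — for homogeneous targets the Def. 4.1 class (LINEAR powers only) is covered as well (`RankMethods.not_linearWaringRankMethodProves`, audit 2026-08-16).
status: theorem (established) [cite: EfremenkoGargOliveiraWigderson2018, Thm. 1.1 and Thm. 1.2] -/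
def RankMethods : Prop :=
  EGOW2018_thm11 ∧ EGOW2018_thm12

/-- The barrier fact follows from the vendored Thm. 4.4 and Thm. 4.2 (Cor. 4.5, Cor. 4.3 of the
paper). [cite: EfremenkoGargOliveiraWigderson2018, Cor. 4.5 and Cor. 4.3] -/
theorem rankMethods_of_thm44_thm42 (h44 : EGOW2018_thm44) (h42 : EGOW2018_thm42) : RankMethods :=
  ⟨h44.thm11, h42.thm12⟩

/-! ### The no-go theorems (proved from the fact) -/

/-- **No rank method certifies tensor rank above `2^d · n^{⌊d/2⌋}`** for any `d`-tensor of side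
`n ≥ 1` over an algebraically closed field of characteristic zero (Thm. 1.1: "for `d = 3`, they
cannot beat `8n`"). [cite: EfremenkoGargOliveiraWigderson2018, Thm. 1.1] -/
theorem RankMethods.not_tensorRankMethodProves (h : RankMethods) (F : Type) [Field F]
    [IsAlgClosed F] [CharZero F] {n : ℕ} (hn : 0 < n) (d : ℕ) (T : (Fin d → Fin n) → F) :
    ¬ TensorRankMethodProves F n d (2 ^ d * n ^ (d / 2)) T := by
  rintro ⟨m, L, r, hr, hlt⟩
  have hle : (L T).rank ≤ 2 ^ d * n ^ (d / 2) * r :=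
    (h.1 F n d hn).apply L (by rintro _ ⟨u, rfl⟩; exact hr u) (Set.mem_univ T)
  exact absurd hlt (not_lt.2 hle)

/-- The case `d = 3`: no rank method certifies tensor rank `> 8n` for any `3`-tensor of side
`n`. [cite: EfremenkoGargOliveiraWigderson2018, Thm. 1.1 (§1.2)] -/
theorem RankMethods.not_tensorRankMethodProves_three (h : RankMethods) (F : Type) [Field F]
    [IsAlgClosed F] [CharZero F] {n : ℕ} (hn : 0 < n) (T : (Fin 3 → Fin n) → F) :
    ¬ TensorRankMethodProves F n 3 (8 * n) T := by
  simpa using h.not_tensorRankMethodProves F hn 3 T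

/-- **No rank method certifies Waring rank above `(d+1) · binom(n+⌊d/2⌋, n)`** for any polynomial
of degree `≤ d` in `n ≥ 1` variables (Thm. 1.2 / Cor. 4.3, affine powers).
[cite: EfremenkoGargOliveiraWigderson2018, Thm. 1.2] -/
theorem RankMethods.not_waringRankMethodProves (h : RankMethods) (F : Type) [Field F]
    [IsAlgClosed F] [CharZero F] {n : ℕ} (hn : 0 < n) (d : ℕ) {f : MvPolynomial (Fin n) F}
    (hf : f.totalDegree ≤ d) :
    ¬ WaringRankMethodProves F n d ((d + 1) * Nat.choose (n + d / 2) n) f := by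
  rintro ⟨m, L, r, hr, hlt⟩
  have hle : (L f).rank ≤ (d + 1) * Nat.choose (n + d / 2) n * r :=
    (h.2 F n d hn).apply L (by rintro _ ⟨a₀, a, rfl⟩; exact hr a₀ a) hf
  exact absurd hlt (not_lt.2 hle)

/-- Arithmetic of the comparison with Raz's threshold: for `n ≥ 16` the tensor ceiling satisfies
`2^d · n^{⌊d/2⌋} ≤ n^{⌈3d/4⌉}` (`⌈3d/4⌉ = (3d+3)/4` in `ℕ`), uniformly in `d` — bounded away in
the exponent from the `n^{d(1-o(1))}` that Raz's route requires. [folklore] -/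
theorem two_pow_mul_pow_half_le {n : ℕ} (hn : 16 ≤ n) (d : ℕ) :
    2 ^ d * n ^ (d / 2) ≤ n ^ ((3 * d + 3) / 4) := by
  have h1 : 2 ^ d ≤ n ^ ((d + 3) / 4) :=
    calc 2 ^ d ≤ 2 ^ (4 * ((d + 3) / 4)) := Nat.pow_le_pow_right (by norm_num) (by omega)
      _ = 16 ^ ((d + 3) / 4) := by rw [pow_mul]; norm_num
      _ ≤ n ^ ((d + 3) / 4) := Nat.pow_le_pow_left hn _
  calc 2 ^ d * n ^ (d / 2) ≤ n ^ ((d + 3) / 4) * n ^ (d / 2) := Nat.mul_le_mul_right _ h1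
    _ = n ^ ((d + 3) / 4 + d / 2) := (pow_add _ _ _).symm
    _ ≤ n ^ ((3 * d + 3) / 4) := Nat.pow_le_pow_right (by omega) (by omega)

/-- Hence, for `n ≥ 16`, no rank method certifies tensor rank above `n^{⌈3d/4⌉}` for any
`d`-tensor of side `n` (monotonicity of the technique class in the bound `B`).
[cite: EfremenkoGargOliveiraWigderson2018, Thm. 1.1 and §1.1 (Raz's route)] -/
theorem RankMethods.not_tensorRankMethodProves_pow (h : RankMethods) (F : Type) [Field F]
    [IsAlgClosed F] [CharZero F] {n : ℕ} (hn : 16 ≤ n) (d : ℕ) (T : (Fin d → Fin n) → F) :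
    ¬ TensorRankMethodProves F n d (n ^ ((3 * d + 3) / 4)) T := by
  rintro ⟨m, L, r, hr, hlt⟩
  refine h.not_tensorRankMethodProves F (by omega) d T ⟨m, L, r, hr, lt_of_le_of_lt ?_ hlt⟩
  exact Nat.mul_le_mul_right _ (two_pow_mul_pow_half_le hn d)

/-! ### Audit 2026-08-16: monotonicity of the classes and coverage of the Def. 4.1
(linear-form) Waring class -/

/-- The tensor technique class is antitone in the certified bound: a certificate for `> B` is one
for every `B' ≤ B`. [folklore] -/
theorem TensorRankMethodProves.mono {F : Type} [Field F] {n d B B' : ℕ}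
    {T : (Fin d → Fin n) → F} (h : TensorRankMethodProves F n d B T) (hB : B' ≤ B) :
    TensorRankMethodProves F n d B' T := by
  obtain ⟨m, L, r, hr, hlt⟩ := h
  exact ⟨m, L, r, hr, lt_of_le_of_lt (Nat.mul_le_mul_right _ hB) hlt⟩

/-- The Waring technique class is antitone in the certified bound. [folklore] -/
theorem WaringRankMethodProves.mono {F : Type} [Field F] {n d B B' : ℕ}
    {f : MvPolynomial (Fin n) F} (h : WaringRankMethodProves F n d B f) (hB : B' ≤ B) :
    WaringRankMethodProves F n d B' f := by
  obtain ⟨m, L, r, hr, hlt⟩ := h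
  exact ⟨m, L, r, hr, lt_of_le_of_lt (Nat.mul_le_mul_right _ hB) hlt⟩

open MvPolynomial in
/-- Linear forms `Σᵢ aᵢ xᵢ` are homogeneous of degree `1`. [folklore] -/
theorem isHomogeneous_linearForm {F : Type*} [CommSemiring F] {n : ℕ} (a : Fin n → F) :
    (linearForm a).IsHomogeneous 1 := by
  unfold linearForm
  exact IsHomogeneous.sum _ _ _ fun i _ => isHomogeneous_C_mul_X (a i) i

open MvPolynomial in
/-- The degree-`d` homogeneous component of the `d`-th power of an affine form `a₀ + ℓ` is `ℓ^d`
(binomial expansion; the `k`-th term `ℓ^k · a₀^{d-k} · binom(d,k)` is homogeneous of degree `k`).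
[folklore] -/
theorem homogeneousComponent_affineForm_pow {F : Type*} [CommSemiring F] {n : ℕ} (a₀ : F)
    (a : Fin n → F) (d : ℕ) :
    homogeneousComponent d (affineForm a₀ a ^ d) = linearForm a ^ d := by
  have haff : affineForm a₀ a = C a₀ + linearForm a := rfl
  rw [haff, add_comm, add_pow, map_sum]
  have hterm : ∀ k ∈ Finset.range (d + 1),
      homogeneousComponent d
          (linearForm a ^ k * C a₀ ^ (d - k) * (d.choose k : MvPolynomial (Fin n) F)) =
        if k = d then linearForm a ^ d else 0 := by
    intro k _
    have hhom : (linearForm a ^ k * C a₀ ^ (d - k) *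
        (d.choose k : MvPolynomial (Fin n) F)).IsHomogeneous k := by
      have h1 : (linearForm a ^ k).IsHomogeneous k := by
        simpa using (isHomogeneous_linearForm a).pow k
      have h2 : (C a₀ ^ (d - k) : MvPolynomial (Fin n) F).IsHomogeneous 0 := by
        rw [← map_pow]; exact isHomogeneous_C _ _
      have h3 : ((d.choose k : ℕ) : MvPolynomial (Fin n) F).IsHomogeneous 0 := by
        rw [← map_natCast C]; exact isHomogeneous_C _ _
      simpa using (h1.mul h2).mul h3
    rw [homogeneousComponent_of_mem hhom]
    by_cases hkd : k = d
    · subst hkd; simp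
    · rw [if_neg (Ne.symm hkd), if_neg hkd]
  rw [Finset.sum_congr rfl hterm, Finset.sum_ite_eq' (Finset.range (d + 1)) d, if_pos (by simp)]

open MvPolynomial in
/-- **The Def. 4.1 Waring technique class (powers of LINEAR forms, homogeneous target) is
covered too.** If `f` is homogeneous of degree `d` (the setting of Def. 4.1), a linear `L` with
`rank L(ℓ^d) ≤ r` for LINEAR forms `ℓ` only — a weaker hypothesis than the affine one of the
printed Thm. 4.2 used in `WaringRankMethodProves` — still cannot certify
`rank L(f) > (d+1)·binom(n+⌊d/2⌋, n) · r`: compose `L` with the projection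
`homogeneousComponent d`, which maps every affine power `(a₀ + ℓ)^d` to `ℓ^d`
(`homogeneousComponent_affineForm_pow`) and fixes `f`, and apply
`RankMethods.not_waringRankMethodProves` to the composite. (Audit 2026-08-16: closes the formal
gap between the affine and the linear technique class.)
[cite: EfremenkoGargOliveiraWigderson2018, Def. 4.1 and Thm. 4.2] -/
theorem RankMethods.not_linearWaringRankMethodProves (h : RankMethods) (F : Type) [Field F]
    [IsAlgClosed F] [CharZero F] {n : ℕ} (hn : 0 < n) (d : ℕ) {f : MvPolynomial (Fin n) F}
    (hf : f.IsHomogeneous d) :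
    ¬ ∃ (m : ℕ) (L : MvPolynomial (Fin n) F →ₗ[F] Matrix (Fin m) (Fin m) F) (r : ℕ),
      (∀ a : Fin n → F, (L (linearForm a ^ d)).rank ≤ r) ∧
        (d + 1) * Nat.choose (n + d / 2) n * r < (L f).rank := by
  rintro ⟨m, L, r, hr, hlt⟩
  refine h.not_waringRankMethodProves F hn d hf.totalDegree_le
    ⟨m, L ∘ₗ homogeneousComponent d, r, fun a₀ a => ?_, ?_⟩
  · rw [LinearMap.comp_apply, homogeneousComponent_affineForm_pow]
    exact hr a
  · rwa [LinearMap.comp_apply, homogeneousComponent_eq_self hf]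

open MvPolynomial in
/-- In particular (honest Waring rank, Def. 4.1): for a homogeneous `f` of degree `d` that has
some Waring decomposition, no linear `L` with `rank L(ℓ^d) ≤ r` on linear powers certifies
`polyWaringRank d f > (d+1)·binom(n+⌊d/2⌋, n)` through `rank L(f) > (d+1)·binom(n+⌊d/2⌋, n) · r`,
although that inequality WOULD prove it (sub-additivity, `rankMeasure_le_sComplexity_mul`).
[cite: EfremenkoGargOliveiraWigderson2018, Def. 4.1 and Cor. 4.3] -/
theorem lt_polyWaringRank_of_certificate {F : Type} [Field F] {n d B m : ℕ}
    {f : MvPolynomial (Fin n) F} (L : MvPolynomial (Fin n) F →ₗ[F] Matrix (Fin m) (Fin m) F)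
    {r : ℕ} (hr : ∀ a : Fin n → F, (L (linearForm a ^ d)).rank ≤ r) (hlt : B * r < (L f).rank)
    (hf : ∃ s : ℕ, ∃ g : Fin s → MvPolynomial (Fin n) F,
      (∀ i, g i ∈ linearPowers F n d) ∧ ∑ i, g i = f) :
    B < polyWaringRank d f := by
  have hle : rankMeasure L f ≤ sComplexity (linearPowers F n d) f * r :=
    rankMeasure_le_sComplexity_mul L (by rintro _ ⟨a, rfl⟩; exact hr a) hf
  rw [rankMeasure_apply] at hle
  exact lt_of_mul_lt_mul_right (lt_of_lt_of_le hlt hle) (Nat.zero_le _)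

end Literature.Barriers.ValiantsHypothesis
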